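import Mathlib
import Summits.ABC.ABC.Theses.RibetTakahashiSplit
import Literature.NumberTheory.DiophantineGeometry.MultiplicativeGroupApproximation

/-!
# Sketch — first lemmas for the crux ideas on `FewPrimeValuationProduct` (stmt-ABC-1563)

Planner scratch (crux-ideate round 1, ideator 1). Nothing here is filed; the statements are the
`First lemma:` lines of the idea cards `Ideas/switching-triangle.md`, `Ideas/hasse-pinning-fixed-level.md`,
`Ideas/matveev-face-clearing.md`.
-/

namespace Summit.ABC.ABC.Cruxes.FewPrimeValuationProduct.Sketch

open Literature.NumberTheory.DiophantineGeometry

/-! ## Card 1 — the switching triangle (pure arithmetic hinge)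

If three positive integers satisfy the three pairwise "Ribet–Takahashi with gcd-bounded cokernel"
inequalities `cᵢ cⱼ ≤ K · R · gcd(cᵢ,cⱼ)²`, then each of them is at most `K² R² G₀²` with
`G₀ = gcd(c_p, c_q, c_r)` (the triple depth). -/

/-- The triangle lemma (provable now, elementary). -/
def TriangleBound : Prop :=
  ∀ K R a b c : ℕ, 0 < a → 0 < b → 0 < c →
    a * b ≤ K * R * (Nat.gcd a b) ^ 2 →
    a * c ≤ K * R * (Nat.gcd a c) ^ 2 →
    b * c ≤ K * R * (Nat.gcd b c) ^ 2 →
      a ≤ K ^ 2 * R ^ 2 * (Nat.gcd a (Nat.gcd b c)) ^ 2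

/-- The key step of the triangle lemma: two divisors of `a` multiply to at most `a` times their gcd. -/
theorem gcd_mul_gcd_le (a b c : ℕ) (ha : 0 < a) :
    Nat.gcd a b * Nat.gcd a c ≤ a * Nat.gcd (Nat.gcd a b) (Nat.gcd a c) := by
  have h1 : Nat.gcd a b ∣ a := Nat.gcd_dvd_left a b
  have h2 : Nat.gcd a c ∣ a := Nat.gcd_dvd_left a c
  have hl : Nat.lcm (Nat.gcd a b) (Nat.gcd a c) ∣ a := Nat.lcm_dvd h1 h2
  have hpos : 0 < Nat.lcm (Nat.gcd a b) (Nat.gcd a c) :=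
    Nat.pos_of_ne_zero (Nat.lcm_ne_zero (Nat.pos_iff_ne_zero.mp (Nat.gcd_pos_of_pos_left b ha))
      (Nat.pos_iff_ne_zero.mp (Nat.gcd_pos_of_pos_left c ha)))
  have hle : Nat.lcm (Nat.gcd a b) (Nat.gcd a c) ≤ a := Nat.le_of_dvd ha hl
  calc Nat.gcd a b * Nat.gcd a c
      = Nat.gcd (Nat.gcd a b) (Nat.gcd a c) * Nat.lcm (Nat.gcd a b) (Nat.gcd a c) :=
        (Nat.gcd_mul_lcm _ _).symm
    _ ≤ Nat.gcd (Nat.gcd a b) (Nat.gcd a c) * a := Nat.mul_le_mul_left _ hle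
    _ = a * Nat.gcd (Nat.gcd a b) (Nat.gcd a c) := Nat.mul_comm _ _

/-! ## Card 2 — Hasse pinning (pure arithmetic hinge)

A congruence modulo `M` between two Frobenius traces lying in the Hasse interval `[-2√v, 2√v]`
is an EQUALITY as soon as `M² > 16 v`. -/

/-- Hasse pinning (provable now, elementary): stated with squares to avoid real square roots. -/
def HassePinning : Prop :=
  ∀ (M : ℕ) (v : ℕ) (a b : ℤ), a ^ 2 ≤ 4 * v → b ^ 2 ≤ 4 * v → (M : ℤ) ∣ a - b →
    16 * (v : ℤ) < (M : ℤ) ^ 2 → a = b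

/-! ## Card 3 — Matveev face-clearing

Every Frey face of the crux in which one of the three terms is a power of two (including `1 = 2⁰`)
has ALL exponents polylogarithmic in the radical; the statement below is the uniform form, to be
proved from the named fact `evertseGyory_thm_4_2_1_rat` (archimedean branch = Matveev, no residue
defect; 2-adic branch = Yu with `p = 2`). -/

/-- Face-clearing: for abc triples supported on at most four primes with a member equal to a power
of two, every exponent is `≤ κ · (log rad)^A` for absolute `A, κ`. -/
def PowerOfTwoFacePolylog : Prop :=
  ∃ A κ : ℝ, ∀ a b c : ℕ, IsABCTriple a b c → (a * b * c).primeFactors.card ≤ 4 →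
    ((∃ j : ℕ, a = 2 ^ j) ∨ (∃ j : ℕ, b = 2 ^ j) ∨ (∃ j : ℕ, c = 2 ^ j)) →
    ∀ p ∈ (a * b * c).primeFactors,
      ((a * b * c).factorization p : ℝ) ≤ κ * (Real.log ((rad a b c : ℕ) : ℝ)) ^ A

/-- The residual hard core (HC) of the Frey part of the crux, in triple language: each member carries
exactly one odd prime. The crux restricted to Frey curves follows from `PowerOfTwoFacePolylog`
and `HardCoreBound` (plus the dictionary `ord_p(Δ_min) = 2·v_p(abc)` for odd `p`). -/
def HardCoreBound : Prop :=
  ∀ ε : ℝ, 0 < ε → ∃ C : ℝ, ∀ p q r x y z k : ℕ, p.Prime → q.Prime → r.Prime →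
    Odd p → Odd q → Odd r → p ≠ q → p ≠ r → q ≠ r → 0 < x → 0 < y → 0 < z → 0 < k →
    (p ^ x + q ^ y = 2 ^ k * r ^ z ∨ p ^ x + 2 ^ k * r ^ z = q ^ y ∨ q ^ y + 2 ^ k * r ^ z = p ^ x) →
      ((x * y * z : ℕ) : ℝ) ≤ C * ((2 * p * q * r : ℕ) : ℝ) ^ ε

/-- The dependency claimed by card 3 (implication shape only; the Frey dictionary lives in the
Theorems file of a prover): face-clearing + hard core ⇒ the crux restricted to abc-Frey triples
with at most three odd primes, in valuation-product form. -/
def FreyFewPrimeValuationProduct : Prop :=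
  ∀ ε : ℝ, 0 < ε → ∃ C : ℝ, ∀ a b c : ℕ, IsABCTriple a b c → (a * b * c).primeFactors.card ≤ 4 →
    ((∏ p ∈ (a * b * c).primeFactors, (a * b * c).factorization p : ℕ) : ℝ) ≤
      C * ((rad a b c : ℕ) : ℝ) ^ ε

theorem freyFewPrime_of_faces_shape :
    (PowerOfTwoFacePolylog → HardCoreBound → FreyFewPrimeValuationProduct) →
    PowerOfTwoFacePolylog → HardCoreBound → FreyFewPrimeValuationProduct :=
  fun h => h

/-- Sanity: the crux decl is in scope (type-checks as a Prop). -/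
example : Prop := Summit.ABC.ABC.Theses.RibetTakahashiSplit.FewPrimeValuationProduct

end Summit.ABC.ABC.Cruxes.FewPrimeValuationProduct.Sketch
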